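import Mathlib.NumberTheory.LegendreSymbol.Basic
import Mathlib.Tactic.LinearCombination
import Mathlib.Tactic.FieldSimp
import HarnessLib

set_option linter.dupNamespace false -- `…BirchSwinnertonDyer.BirchSwinnertonDyer…` is the cell's namespace (D-0017)
set_option autoImplicit false

/-!
# The split symbol `σ(ℓ)` of the family `𝒮` IS the rational quartic residue symbol `(−7/ℓ)₄`:
# c301's `hσ`-currency and CLTZ's «type α / type β» currency (`x⁴ ≡ −7 (mod p)`) agree, as kernel theorems

Cell `bsd-goldfeld`, seat `bsd-goldfeld-s1p-c301` (prover, gen 18); planner RULING (cclxxiv); `--supports stmt-BirchSwinnertonDyer-19140`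
(twin″) as a HELPER. Theses-free, Mathlib-only; theorems only (no definition / instance / named fact / `sorry`). Nothing here decides a
twist; BSD is not proved by any of this. THE TWO CURRENCIES: the `𝒮`-files of this seat (`…TwinInertSevenSplitSymbol[Families]`, F/R/H2/K,
UNION-14, ONE-BIT) bind the split symbol as `hσ : ∀ s : ZMod ℓ, s ^ 2 = -7 → ¬ IsSquare (2 * (s - 21))` («`σ(ℓ) = −1`», the symbol
`[(−21 + √−7)/2 mod 𝔩]`); seat c3x's quarter-trace files (THEOREM A⁗_β) bind Coates–Li–Tian–Zhai's TYPE of a prime `p ≡ 1 (mod 4)`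
split in `ℚ(√−7)`: type β iff `hβ : ∃ x : ZMod p, x ^ 4 = -7`, type α iff not (CLTZ 2015 §5; memo `RK2-MIXED-FAMILY.md` l.21/l.126 had
`σ = (−7/p)₄` only numerically, 132/132, and types THEOREM A⁗_α with `hσ`). THE IDENTITY: in any commutative ring `s² = −7` implies
**`8(s − 21) = s·(1 − s)⁴`** (`s(1 − s)⁴ − 8(s − 21) = (s² + 7)(s³ − 4s² − s + 24)`; over `ℚ(√−7)`: `x(T₁) − 2 = (−21 + √−7)/8 = √−7·(π̄/π)²`,
`π = (1 + √−7)/2`, `T₁` a non-rational `2`-torsion point of `X₀(49)`). Hence in `𝔽_p`, `p` odd, `2(s − 21)` is a square iff `s` is (§1);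
for `p ≡ 1 (mod 4)` (the roots `±s` of `s² = −7` then share one quadratic character): `σ(p) = −1` ⟺ type α, and `σ(p) = +1` ⟺ type β
when `(−7/p) = +1` (§2); §3 is the dichotomy «type β ∨ σ = −1» that makes unions over all `p ≡ 5 (mod 8)`, `(−7/p) = +1` exhaustive
(the `hl8 : ℓ % 8 = 5` binder of the `𝒮`-files feeds `hp4` by `(by omega)`).
References: Coates–Li–Tian–Zhai, PLMS 110 (2015) §5 [CoatesLiTianZhai2015]; Silverman, *AEC* (2009) X.4.9 [SilvermanAEC2009].
-/


namespace Summit.BirchSwinnertonDyer.BirchSwinnertonDyer.Theorems.GoldfeldGoodTwists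

/-! ## §1 The identity and the square-class transfer -/

/-- **The split-symbol/quartic identity**: in any commutative ring, `s² = −7` implies `8(s − 21) = s(1 − s)⁴`
(since `s(1 − s)⁴ − 8(s − 21) = (s² + 7)(s³ − 4s² − s + 24)`). [folklore] -/
theorem eight_mul_sub_twentyOne_eq_of_sq_eq_neg_seven {R : Type*} [CommRing R] {s : R} (hs : s ^ 2 = -7) :
    8 * (s - 21) = s * (1 - s) ^ 4 := by
  linear_combination (-(s ^ 3) + 4 * s ^ 2 + s - 24) * hs

section ZModPrime

variable {p : ℕ} [Fact p.Prime]

/-- **Square-class transfer**: for an odd prime `p` and `s ∈ 𝔽_p` with `s² = −7`, `2(s − 21)` is a square in `𝔽_p`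
iff `s` is — because `2(s − 21)·2² = s·((1 − s)²)²` with `2 ≠ 0` and `1 − s ≠ 0` (else `8 = 0`). [folklore] -/
theorem isSquare_two_mul_sub_twentyOne_iff (hp2 : p ≠ 2) {s : ZMod p} (hs : s ^ 2 = -7) :
    IsSquare (2 * (s - 21)) ↔ IsSquare s := by
  have hp : p.Prime := Fact.out
  have hdvd2 : ¬ p ∣ 2 := fun h ↦ hp2 ((Nat.prime_dvd_prime_iff_eq hp Nat.prime_two).1 h)
  -- in the field `𝔽_p`, multiplying by a non-zero square does not change squareness
  have transfer : ∀ {a c : ZMod p}, c ≠ 0 → (IsSquare (a * c ^ 2) ↔ IsSquare a) := fun {a c} hc ↦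
    ⟨fun ⟨r, hr⟩ ↦ ⟨r / c, by field_simp; linear_combination hr⟩, fun ⟨r, hr⟩ ↦ ⟨r * c, by rw [hr]; ring⟩⟩
  have h2 : (2 : ZMod p) ≠ 0 := fun h ↦
    hdvd2 ((ZMod.natCast_eq_zero_iff 2 p).1 (by exact_mod_cast h))
  have h1s : (1 - s) ≠ 0 := fun h ↦ by
    have h8 : ((8 : ℕ) : ZMod p) = 0 := by push_cast; linear_combination (1 + s) * h + hs
    exact hdvd2 (hp.dvd_of_dvd_pow (show p ∣ 2 ^ 3 by simpa using (ZMod.natCast_eq_zero_iff 8 p).1 h8))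
  have key : 2 * (s - 21) * 2 ^ 2 = s * ((1 - s) ^ 2) ^ 2 := by
    linear_combination (-(s ^ 3) + 4 * s ^ 2 + s - 24) * hs
  calc IsSquare (2 * (s - 21)) ↔ IsSquare (2 * (s - 21) * 2 ^ 2) := (transfer h2).symm
    _ ↔ IsSquare (s * ((1 - s) ^ 2) ^ 2) := by rw [key]
    _ ↔ IsSquare s := transfer (pow_ne_zero 2 h1s)

/-! ## §2 The split symbol is the quartic residue symbol `(−7/p)₄` -/

/-- `x⁴ = −7` is solvable in `𝔽_p` iff some square root of `−7` is itself a square. [folklore] -/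
theorem exists_pow_four_eq_neg_seven_iff :
    (∃ x : ZMod p, x ^ 4 = -7) ↔ ∃ s : ZMod p, s ^ 2 = -7 ∧ IsSquare s :=
  ⟨fun ⟨x, hx⟩ ↦ ⟨x ^ 2, by rw [← hx]; ring, x, by ring⟩, fun ⟨s, hs, r, hr⟩ ↦ ⟨r, by rw [← hs, hr]; ring⟩⟩

/-- For `p ≡ 1 (mod 4)` the two square roots `±s₀` of `−7` in `𝔽_p` have the same quadratic character: if ONE root is a
square, ALL are. [folklore] -/
theorem forall_isSquare_of_sq_eq_neg_seven (hp4 : p % 4 = 1) {s₀ : ZMod p} (hs₀ : s₀ ^ 2 = -7) (hsq : IsSquare s₀) :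
    ∀ s : ZMod p, s ^ 2 = -7 → IsSquare s := by
  intro s hs
  rcases sq_eq_sq_iff_eq_or_eq_neg.1 (hs.trans hs₀.symm) with h | h
  · rw [h]; exact hsq
  · rw [h, neg_eq_neg_one_mul]; exact (ZMod.exists_sq_eq_neg_one_iff.2 (by omega)).mul hsq

/-- **`σ(p) = −1` ⟺ type α.** For a prime `p ≡ 1 (mod 4)`: c301's negative split symbol
`∀ s, s² = −7 → 2(s − 21) ∉ 𝔽_p²` holds iff `x⁴ = −7` has NO solution in `𝔽_p` (both sides hold vacuously when `(−7/p) = −1`).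
[cite: CoatesLiTianZhai2015, §5 (types α and β)] -/
theorem symbolNeg_iff_not_exists_pow_four (hp4 : p % 4 = 1) :
    (∀ s : ZMod p, s ^ 2 = -7 → ¬ IsSquare (2 * (s - 21))) ↔ ¬ ∃ x : ZMod p, x ^ 4 = -7 := by
  have hp2 : p ≠ 2 := by rintro rfl; norm_num at hp4
  rw [exists_pow_four_eq_neg_seven_iff]
  exact ⟨fun h ⟨s, hs, hsq⟩ ↦ h s hs ((isSquare_two_mul_sub_twentyOne_iff hp2 hs).2 hsq),
    fun h s hs hsq ↦ h ⟨s, hs, (isSquare_two_mul_sub_twentyOne_iff hp2 hs).1 hsq⟩⟩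

/-- **`σ(p) = +1` ⟺ type β.** For a prime `p ≡ 1 (mod 4)` with `(−7/p) = +1`: c301's positive split symbol
`∀ s, s² = −7 → 2(s − 21) ∈ 𝔽_p²` holds iff `x⁴ = −7` HAS a solution in `𝔽_p`. [cite: CoatesLiTianZhai2015, §5 (types α and β)] -/
theorem symbolPos_iff_exists_pow_four (hp4 : p % 4 = 1) (hp7 : legendreSym p (-7) = 1) :
    (∀ s : ZMod p, s ^ 2 = -7 → IsSquare (2 * (s - 21))) ↔ ∃ x : ZMod p, x ^ 4 = -7 := by
  have hp2 : p ≠ 2 := by rintro rfl; norm_num at hp4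
  have h70 : ((-7 : ℤ) : ZMod p) ≠ 0 := fun h0 ↦ by
    rw [(legendreSym.eq_zero_iff p (-7)).2 h0] at hp7
    exact zero_ne_one hp7
  obtain ⟨s₀, hs₀⟩ := (legendreSym.eq_one_iff p h70).1 hp7
  have hs₀' : s₀ ^ 2 = -7 := by rw [sq, ← hs₀]; push_cast; ring
  rw [exists_pow_four_eq_neg_seven_iff]
  exact ⟨fun h ↦ ⟨s₀, hs₀', (isSquare_two_mul_sub_twentyOne_iff hp2 hs₀').1 (h s₀ hs₀')⟩, fun ⟨s, hs, hsq⟩ s' hs' ↦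
    (isSquare_two_mul_sub_twentyOne_iff hp2 hs').2 (forall_isSquare_of_sq_eq_neg_seven hp4 hs hsq s' hs')⟩

/-! ## §3 The dichotomy in the shapes the consumers bind -/

/-- **Type β or `σ = −1`, exhaustively** (`p ≡ 1 (mod 4)`): either the `hβ` binder of the quarter-trace files or the `hσ` binder
of `𝒮|σ=−1` / THEOREM A⁗_α holds. [cite: CoatesLiTianZhai2015, §5 (types α and β)] -/
theorem exists_pow_four_eq_neg_seven_or_symbolNeg (hp4 : p % 4 = 1) :
    (∃ x : ZMod p, x ^ 4 = -7) ∨ (∀ s : ZMod p, s ^ 2 = -7 → ¬ IsSquare (2 * (s - 21))) := by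
  rw [symbolNeg_iff_not_exists_pow_four hp4]
  exact em _

/-- **… and never both**: type β and `σ = −1` are incompatible (`p ≡ 1 (mod 4)`). [cite: CoatesLiTianZhai2015, §5 (types α and β)] -/
theorem not_symbolNeg_of_exists_pow_four (hp4 : p % 4 = 1) (hβ : ∃ x : ZMod p, x ^ 4 = -7) :
    ¬ ∀ s : ZMod p, s ^ 2 = -7 → ¬ IsSquare (2 * (s - 21)) := fun hσ ↦
  (symbolNeg_iff_not_exists_pow_four hp4).1 hσ hβ

end ZModPrime

end Summit.BirchSwinnertonDyer.BirchSwinnertonDyer.Theorems.GoldfeldGoodTwists
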